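import Literature.Geometry.GeometricMeasureTheory.CurrentsEuclideanCycle
import Mathlib.LinearAlgebra.Multilinear.FiniteDimensional
import Mathlib.Analysis.Calculus.FDeriv.ContinuousAlternatingMap
import Mathlib.Analysis.Normed.Module.Multilinear.Basic
import Mathlib.Analysis.Calculus.ContDiff.Operations
import HarnessLib

/-!
# Stokes for pulled-back forms along a chart: `∫_W d(Ψ^*ψ) = 0`

Brick R8a of the proof of the named fact
`Literature.Geometry.Kaehler.Harvey1977_boundary_toCurrent_eq_zero`: the chart-level Stokes
theorem to which "`d[Reg V] = 0` off `Sing V`" [Harvey1977, Lemma 1.8] reduces after the area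
formula. Everything is proved from Mathlib and `CurrentsEuclideanCycle.lean`; no definitions, no
named facts.

Let `K` be a finite-dimensional real normed space with an additive Haar measure `μ`, `W ⊆ K`
open, `Ψ : K → V` of class `C²` on `W`, `ψ` a `C¹` differential `n`-form on `V`, and suppose
`ψ ∘ Ψ` vanishes on `W` off a compact subset `C ⊆ W`. Then for every constant `(n+1)`-frame `e`
of `K`,

* `integral_extDeriv_pullback_eq_zero` — **`∫_W (Ψ^* dψ)(e) dμ = 0`**, i.e.
  `∫_{k ∈ W} dψ(Ψ k)(DΨ(k) e₀, …, DΨ(k) eₙ) dμ(k) = 0`: the pulled-back form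
  `Ψ^*ψ = (ψ ∘ Ψ).compContinuousLinearMap (DΨ)` extends by zero to a compactly supported `C¹`
  form on `K`, `d(Ψ^*ψ) = Ψ^*(dψ)` on `W` (Mathlib's `extDeriv_pullback`), and `∫_K dω(e) = 0` for
  compactly supported `C¹` forms (`integral_extDeriv_apply_eq_zero`, i.e. `∂𝐄ⁿ = 0`).

On the way: `finiteDimensional_continuousMultilinearMap`,
`finiteDimensional_continuousAlternatingMap` (multilinear/alternating maps between
finite-dimensional spaces form a finite-dimensional space) and
`ContDiffOn.continuousAlternatingMapCompContinuousLinearMap` (smoothness of pulled-back forms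
`x ↦ (A x).compContinuousLinearMap (L x)`).

## References

* H. Federer, *Geometric Measure Theory*, Springer 1969, 4.1.6–4.1.7 (`f^#`, `∂𝐄ⁿ = 0`).
* R. Harvey, *Holomorphic chains and their boundaries*, PSPUM XXX.1 (1977), Lemma 1.8.
-/

noncomputable section

open MeasureTheory Set Function Filter Topology

namespace Literature.Geometry.GeometricMeasureTheory

/-! ### Forms on a finite-dimensional space form a finite-dimensional space -/

section FinDim

variable {K : Type*} [NormedAddCommGroup K] [NormedSpace ℝ K] [FiniteDimensional ℝ K]
  {F : Type*} [NormedAddCommGroup F] [NormedSpace ℝ F] [FiniteDimensional ℝ F]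
  {ι : Type*} [Fintype ι]

/-- Continuous multilinear maps between finite-dimensional spaces form a finite-dimensional
space. [folklore] -/
theorem finiteDimensional_continuousMultilinearMap :
    FiniteDimensional ℝ (ContinuousMultilinearMap ℝ (fun _ : ι => K) F) :=
  Module.Finite.of_injective
    (ContinuousMultilinearMap.toMultilinearMapLinear :
      ContinuousMultilinearMap ℝ (fun _ : ι => K) F →ₗ[ℝ] MultilinearMap ℝ (fun _ : ι => K) F)
    fun _ _ h => ContinuousMultilinearMap.toMultilinearMap_injective h

/-- Continuous alternating maps between finite-dimensional spaces form a finite-dimensional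
space. [folklore] -/
theorem finiteDimensional_continuousAlternatingMap : FiniteDimensional ℝ (K [⋀^ι]→L[ℝ] F) := by
  haveI := finiteDimensional_continuousMultilinearMap (K := K) (F := F) (ι := ι)
  exact Module.Finite.of_injective
    ((ContinuousAlternatingMap.toContinuousMultilinearMapCLM ℝ :
      (K [⋀^ι]→L[ℝ] F) →L[ℝ] ContinuousMultilinearMap ℝ (fun _ : ι => K) F) :
      (K [⋀^ι]→L[ℝ] F) →ₗ[ℝ] ContinuousMultilinearMap ℝ (fun _ : ι => K) F)
    ContinuousAlternatingMap.toContinuousMultilinearMap_injective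

end FinDim

/-! ### Smoothness of pulled-back forms -/

section Pullback

variable {X : Type*} [NormedAddCommGroup X] [NormedSpace ℝ X]
  {K : Type*} [NormedAddCommGroup K] [NormedSpace ℝ K] [FiniteDimensional ℝ K]
  {V : Type*} [NormedAddCommGroup V] [NormedSpace ℝ V]
  {F : Type*} [NormedAddCommGroup F] [NormedSpace ℝ F] [FiniteDimensional ℝ F]
  {ι : Type*} [Fintype ι] {n : WithTop ℕ∞}

/-- **Pulled-back forms are as smooth as their data**: if `A : X → (F-valued alternating maps
on V)` and `L : X → (K →L V)` are `Cⁿ` on `s`, so is `x ↦ (A x).compContinuousLinearMap (L x)`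
(alternating maps on `K`; here `K` and `F` are finite-dimensional). The underlying multilinear
map is `Cⁿ` because composition with linear maps is a continuous multilinear operation in the
linear maps (Mathlib's `ContinuousMultilinearMap.compContinuousLinearMapContinuousMultilinear`);
the embedding of alternating into multilinear maps has a continuous linear left inverse (finite
dimension). [folklore] -/
theorem _root_.ContDiffOn.continuousAlternatingMapCompContinuousLinearMap
    {A : X → V [⋀^ι]→L[ℝ] F} {L : X → (K →L[ℝ] V)} {s : Set X}
    (hA : ContDiffOn ℝ n A s) (hL : ContDiffOn ℝ n L s) :
    ContDiffOn ℝ n (fun x => (A x).compContinuousLinearMap (L x)) s := by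
  classical
  set Φ := ContinuousMultilinearMap.compContinuousLinearMapContinuousMultilinear ℝ
    (fun _ : ι => K) (fun _ : ι => V) F with hΦ
  have h1 : ContDiffOn ℝ n
      (fun x => Φ (fun _ => L x) (A x).toContinuousMultilinearMap) s := by
    have hL' : ContDiffOn ℝ n (fun x => (fun _ : ι => L x)) s := contDiffOn_pi.2 fun _ => hL
    have hA' : ContDiffOn ℝ n (fun x => (A x).toContinuousMultilinearMap) s :=
      ((ContinuousAlternatingMap.toContinuousMultilinearMapCLM ℝ :
        (V [⋀^ι]→L[ℝ] F) →L[ℝ] ContinuousMultilinearMap ℝ (fun _ : ι => V) F).contDiff).comp_contDiffOn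
        hA
    have hΦ' := (Φ.contDiff (n := n)).comp_contDiffOn hL'
    exact hΦ'.clm_apply hA'
  -- a continuous linear left inverse of the embedding into multilinear maps
  haveI := finiteDimensional_continuousMultilinearMap (K := K) (F := F) (ι := ι)
  haveI := finiteDimensional_continuousAlternatingMap (K := K) (F := F) (ι := ι)
  obtain ⟨P, hP⟩ : ∃ P : ContinuousMultilinearMap ℝ (fun _ : ι => K) F →L[ℝ] (K [⋀^ι]→L[ℝ] F),
      ∀ θ : K [⋀^ι]→L[ℝ] F, P θ.toContinuousMultilinearMap = θ := by
    obtain ⟨g, hg⟩ := LinearMap.exists_leftInverse_of_injective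
      ((ContinuousAlternatingMap.toContinuousMultilinearMapCLM ℝ :
        (K [⋀^ι]→L[ℝ] F) →L[ℝ] ContinuousMultilinearMap ℝ (fun _ : ι => K) F) :
        (K [⋀^ι]→L[ℝ] F) →ₗ[ℝ] ContinuousMultilinearMap ℝ (fun _ : ι => K) F)
      (LinearMap.ker_eq_bot.2 ContinuousAlternatingMap.toContinuousMultilinearMap_injective)
    refine ⟨LinearMap.toContinuousLinearMap g, fun θ => ?_⟩
    exact congrArg (fun f : (K [⋀^ι]→L[ℝ] F) →ₗ[ℝ] (K [⋀^ι]→L[ℝ] F) => f θ) hg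
  have heq : ∀ x, (A x).compContinuousLinearMap (L x) =
      P (Φ (fun _ => L x) (A x).toContinuousMultilinearMap) := fun x => by
    rw [← hP ((A x).compContinuousLinearMap (L x))]
    congr 1
  refine (P.contDiff.comp_contDiffOn h1).congr fun x _ => heq x

omit [FiniteDimensional ℝ K] in
/-- `extDeriv` of an eventually-zero form vanishes. [folklore] -/
theorem extDeriv_eq_zero_of_eventuallyEq_zero {m : ℕ} {θ : K → K [⋀^Fin m]→L[ℝ] ℝ} {x : K}
    (h : θ =ᶠ[𝓝 x] fun _ => 0) : extDeriv θ x = 0 := by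
  rw [h.extDeriv_eq]
  ext w
  simp [extDeriv, ContinuousAlternatingMap.alternatizeUncurryFin_apply]

variable [MeasurableSpace K] [BorelSpace K] (μ : Measure K) [μ.IsAddHaarMeasure]

/-- **Stokes for pulled-back forms along a chart.** Let `W ⊆ K` be open, `Ψ : K → V` of class
`C²` on `W`, `ψ` a `C¹` differential `m`-form on `V` with `ψ (Ψ k) = 0` for `k ∈ W` outside a
compact set `C ⊆ W`. Then for every constant `(m+1)`-frame `e` of `K`,
`∫_{k ∈ W} dψ(Ψ k)(DΨ(k) e₀, …, DΨ(k) eₘ) dμ(k) = 0`: extend `Ψ^*ψ` by zero to a compactly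
supported `C¹` form `ω₁` on `K`; on `W`, `dω₁ = Ψ^*(dψ)` (`extDeriv_pullback`); and
`∫_K dω₁(e) dμ = 0` (`integral_extDeriv_apply_eq_zero`, Federer's `∂𝐄ⁿ = 0`). This is the
chart-level form of "`d[Reg V] = 0` off `Sing V`". [cite: Federer1969, 4.1.7; Harvey1977, Lemma 1.8] -/
theorem integral_extDeriv_pullback_eq_zero {m : ℕ} {W : Set K} (hW : IsOpen W) {Ψ : K → V}
    (hΨ : ContDiffOn ℝ 2 Ψ W) {ψ : V → V [⋀^Fin m]→L[ℝ] ℝ} (hψ : ContDiff ℝ 1 ψ) {C : Set K}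
    (hC : IsCompact C) (hCW : C ⊆ W) (hzero : ∀ k ∈ W, k ∉ C → ψ (Ψ k) = 0)
    (e : Fin (m + 1) → K) :
    ∫ k in W, (extDeriv ψ (Ψ k)).compContinuousLinearMap (fderiv ℝ Ψ k) e ∂μ = 0 := by
  classical
  -- the pulled-back form and its extension by zero
  set ω₀ : K → K [⋀^Fin m]→L[ℝ] ℝ := fun k => (ψ (Ψ k)).compContinuousLinearMap (fderiv ℝ Ψ k)
    with hω₀_def
  have hω₀ : ContDiffOn ℝ 1 ω₀ W :=
    (hψ.comp_contDiffOn (hΨ.of_le (by norm_num))).continuousAlternatingMapCompContinuousLinearMap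
      (hΨ.fderiv_of_isOpen hW (by norm_num))
  set ω₁ : K → K [⋀^Fin m]→L[ℝ] ℝ := fun k => if k ∈ W then ω₀ k else 0 with hω₁_def
  have hagree : ∀ k ∈ W, ω₁ =ᶠ[𝓝 k] ω₀ := fun k hk => by
    filter_upwards [hW.mem_nhds hk] with k' hk'
    simp [hω₁_def, hk']
  have hvanish : ∀ k ∉ C, ω₁ =ᶠ[𝓝 k] fun _ => 0 := fun k hk => by
    filter_upwards [hC.isClosed.isOpen_compl.mem_nhds hk] with k' hk'
    by_cases hk'W : k' ∈ W
    · simp only [hω₁_def, hk'W, if_true, hω₀_def, hzero k' hk'W hk']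
      ext v
      simp
    · simp [hω₁_def, hk'W]
  have hω₁ : ContDiff ℝ 1 ω₁ := contDiff_iff_contDiffAt.2 fun k => by
    by_cases hk : k ∈ W
    · exact (hω₀.contDiffAt (hW.mem_nhds hk)).congr_of_eventuallyEq (hagree k hk)
    · exact contDiffAt_const.congr_of_eventuallyEq (hvanish k fun h => hk (hCW h))
  have hsupp : HasCompactSupport ω₁ := by
    refine HasCompactSupport.intro hC fun k hk => ?_
    exact (hvanish k hk).self_of_nhds
  -- `∂𝐄ⁿ = 0` for `ω₁`
  have h0 := integral_extDeriv_apply_eq_zero (μ := μ) hω₁ hsupp e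
  -- on `W`, `dω₁ = Ψ^*(dψ)`; off `W`, `dω₁ = 0`
  have hin : EqOn (fun k => (extDeriv ψ (Ψ k)).compContinuousLinearMap (fderiv ℝ Ψ k) e)
      (fun k => extDeriv ω₁ k e) W := fun k hk => by
    have hΨk : ContDiffAt ℝ 2 Ψ k := hΨ.contDiffAt (hW.mem_nhds hk)
    have hψk : DifferentiableAt ℝ ψ (Ψ k) := (hψ.differentiable one_ne_zero).differentiableAt
    simp only
    rw [(hagree k hk).extDeriv_eq, hω₀_def, extDeriv_pullback hψk hΨk]
    rw [minSmoothness_of_isRCLikeNormedField]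
  have hout : ∀ k, k ∉ W → extDeriv ω₁ k e = 0 := fun k hk => by
    rw [extDeriv_eq_zero_of_eventuallyEq_zero (hvanish k fun h => hk (hCW h))]
    rfl
  calc ∫ k in W, (extDeriv ψ (Ψ k)).compContinuousLinearMap (fderiv ℝ Ψ k) e ∂μ
      = ∫ k in W, extDeriv ω₁ k e ∂μ := setIntegral_congr_fun hW.measurableSet hin
    _ = ∫ k, extDeriv ω₁ k e ∂μ := setIntegral_eq_integral_of_forall_compl_eq_zero hout
    _ = 0 := h0

end Pullback

end Literature.Geometry.GeometricMeasureTheory
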